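import Mathlib
import Literature.Computability.AlgebraicComplexity.HessianAtOrigin
import Summits.ValiantsHypothesis.ValiantsHypothesis.Theorems.GrenetZeonTwoDimCoefficientsTraceChainHessian
import Summits.ValiantsHypothesis.ValiantsHypothesis.Theorems.GrenetZeonTwoDimCoefficientsDualUnipotentCommutativeRepr

/-!
# Crux `GrenetZeon.TwoDimCoefficients` (stmt-ValiantsHypothesis-8062) / rung `DualUnipotentThreeHalves` (stmt-24318):
# the Hessian of the TRACE OF A PRODUCT OF AFFINE MATRICES at every point (product rule, general factors)

Memo TWENTY-SECOND HAND §6 (R1)/(R2): beyond exactly-graded pencils the resolvent cross formula no longer isolates the top trace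
`tr(N^{n−1}·M)`, and the slot calculus must start from the Hessian of a single product `tr(A₀·A₁⋯A_{K−1})` of affine matrix
families.  This file generalises the prefix-product calculus of ✓ `…TraceChainHessian` (there: free square blocks at one special
point) to ARBITRARY families `B : ℕ → Matrix` over `MvPolynomial σ ℂ` and, for affine families, to EVERY point:

* `map_pderiv_pprod` — Leibniz: `∂_s (B₀⋯B_{K−1}) = Σ_{a<K} B₀⋯(∂_s B_a)⋯B_{K−1}` (no hypothesis on `B`);
* `map_pderiv_map_pderiv_pprod` — second Leibniz: `∂_s∂_t (B₀⋯B_{K−1}) = Σ_{a≠b} ⋯(∂_s B_a)⋯(∂_t B_b)⋯ + Σ_a ⋯(∂_s∂_t B_a)⋯`;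
* ★ `hess0_transl_trace_pprod_of_isAffine` — for AFFINE `B_a` and every point `z`:
  `Hess_z tr(B₀⋯B_{K−1})(s,t) = Σ_{a<K} Σ_{b<K, b≠a} tr(B₀(z)⋯[x_s]B_a⋯[x_t]B_b⋯B_{K−1}(z))`
  (`[x_s]B_a` = the coefficient matrix of `x_s`, `B_c(z)` = the value at `z`).

Pure formal calculus, def-free (uses ✓ `TraceChain.pprod`).  HONEST FRAMING: a brick for the next extension of Theorem T7 (bounded jumps /
diagonal classes); the stub `DualUnipotentBound`, the 24318 decl and `VP ≠ VNP` remain open.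

References: folklore.
-/

set_option linter.dupNamespace false
set_option autoImplicit false

noncomputable section

namespace Summit.ValiantsHypothesis.ValiantsHypothesis.Theorems.GrenetZeonTwoDimCoefficients.TraceProductHessian

open Matrix MvPolynomial
open Literature.Computability.AlgebraicComplexity
open Summit.ValiantsHypothesis.ValiantsHypothesis.Cruxes.TwoDimCoefficients.DimTwoCases
  (TraceChain.pprod TraceChain.pprod_zero TraceChain.pprod_succ TraceChain.pprod_map TraceChain.map_pderiv_mul
    CommutativePencil.map_pderiv_of_isAffine)

variable {σ : Type} {w : ℕ}

/-! ### Prefix products only see the factors below the length -/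

/-- `pprod g K` depends only on `g 0, …, g (K−1)`. [folklore] -/
theorem pprod_congr {R : Type} [Semiring R] {g g' : ℕ → Matrix (Fin w) (Fin w) R} :
    ∀ K : ℕ, (∀ j, j < K → g j = g' j) → TraceChain.pprod w g K = TraceChain.pprod w g' K
  | 0, _ => by rw [TraceChain.pprod_zero, TraceChain.pprod_zero]
  | K + 1, h => by
      rw [TraceChain.pprod_succ, TraceChain.pprod_succ, pprod_congr K (fun j hj => h j (by omega)), h K (by omega)]

/-- Updating a factor at an index `≥ K` does not change `pprod · K`. [folklore] -/
theorem pprod_update_of_le {R : Type} [Semiring R] (g : ℕ → Matrix (Fin w) (Fin w) R) {a K : ℕ} (h : K ≤ a)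
    (X : Matrix (Fin w) (Fin w) R) : TraceChain.pprod w (Function.update g a X) K = TraceChain.pprod w g K :=
  pprod_congr K fun j hj => by rw [Function.update_of_ne (by omega)]

/-! ### Leibniz rules for prefix products -/

/-- The derivative of a constant-one matrix vanishes. [folklore] -/
theorem map_pderiv_one (s : σ) : (1 : Matrix (Fin w) (Fin w) (MvPolynomial σ ℂ)).map (pderiv s) = 0 := by
  refine Matrix.ext fun i j => ?_
  rw [Matrix.map_apply, Matrix.one_apply, Matrix.zero_apply]
  split_ifs
  · exact Derivation.map_one_eq_zero (pderiv s)
  · exact map_zero (pderiv s)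

/-- Finite sums commute with entrywise additive maps. [folklore] -/
theorem map_sum_pderiv (s : σ) {ι : Type*} (S : Finset ι) (X : ι → Matrix (Fin w) (Fin w) (MvPolynomial σ ℂ)) :
    (∑ i ∈ S, X i).map (pderiv s) = ∑ i ∈ S, (X i).map (pderiv s) := by
  refine Matrix.ext fun a b => ?_
  simp only [Matrix.map_apply, Matrix.sum_apply, map_sum]

/-- **Leibniz rule for prefix products**: `∂_s (B₀⋯B_{K−1}) = Σ_{a<K} B₀⋯(∂_s B_a)⋯B_{K−1}`. [folklore] -/
theorem map_pderiv_pprod (B : ℕ → Matrix (Fin w) (Fin w) (MvPolynomial σ ℂ)) (s : σ) :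
    ∀ K : ℕ, (TraceChain.pprod w B K).map (pderiv s) =
      ∑ a ∈ Finset.range K, TraceChain.pprod w (Function.update B a ((B a).map (pderiv s))) K
  | 0 => by rw [TraceChain.pprod_zero, map_pderiv_one, Finset.sum_range_zero]
  | K + 1 => by
      rw [TraceChain.pprod_succ, TraceChain.map_pderiv_mul, map_pderiv_pprod B s K, Finset.sum_range_succ,
        Finset.sum_mul]
      congr 1
      · refine Finset.sum_congr rfl fun a ha => ?_
        rw [Finset.mem_range] at ha
        rw [TraceChain.pprod_succ, Function.update_of_ne (by omega)]
      · rw [TraceChain.pprod_succ, Function.update_self, pprod_update_of_le B le_rfl]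

/-- **Second Leibniz rule**: `∂_s∂_t (B₀⋯B_{K−1}) = Σ_{a<K} Σ_{b<K, b≠a} ⋯(∂_s B_a)⋯(∂_t B_b)⋯ + Σ_{a<K} ⋯(∂_s∂_t B_a)⋯`.
[folklore] -/
theorem map_pderiv_map_pderiv_pprod (B : ℕ → Matrix (Fin w) (Fin w) (MvPolynomial σ ℂ)) (s t : σ) (K : ℕ) :
    ((TraceChain.pprod w B K).map (pderiv t)).map (pderiv s) =
      (∑ a ∈ Finset.range K, ∑ b ∈ (Finset.range K).erase a,
        TraceChain.pprod w (Function.update (Function.update B a ((B a).map (pderiv s))) b ((B b).map (pderiv t))) K) +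
      ∑ a ∈ Finset.range K, TraceChain.pprod w (Function.update B a (((B a).map (pderiv t)).map (pderiv s))) K := by
  classical
  rw [map_pderiv_pprod B t K, map_sum_pderiv]
  -- differentiate each summand with the first Leibniz rule
  have hterm : ∀ b ∈ Finset.range K,
      (TraceChain.pprod w (Function.update B b ((B b).map (pderiv t))) K).map (pderiv s) =
        (∑ a ∈ (Finset.range K).erase b,
          TraceChain.pprod w (Function.update (Function.update B a ((B a).map (pderiv s))) b ((B b).map (pderiv t))) K) +
        TraceChain.pprod w (Function.update B b (((B b).map (pderiv t)).map (pderiv s))) K := by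
    intro b hb
    rw [map_pderiv_pprod _ s K, ← Finset.add_sum_erase _ _ hb, add_comm]
    congr 1
    · refine Finset.sum_congr rfl fun a ha => ?_
      have hab : a ≠ b := (Finset.mem_erase.mp ha).1
      rw [Function.update_of_ne hab, Function.update_comm hab]
    · rw [Function.update_self, Function.update_idem]
  rw [Finset.sum_congr rfl hterm, Finset.sum_add_distrib]
  congr 1
  -- swap the double sum over `a ≠ b`
  rw [Finset.sum_comm' (t' := Finset.range K) (s' := fun a => (Finset.range K).erase a)]
  intro b a
  simp only [Finset.mem_erase, Finset.mem_range]
  tauto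

/-! ### The Hessian of the trace of an affine product at a point -/

/-- Mapping an updated family entrywise. [folklore] -/
theorem map_update {R S : Type} [Semiring R] [Semiring S] (f : R →+* S) (g : ℕ → Matrix (Fin w) (Fin w) R) (a : ℕ)
    (X : Matrix (Fin w) (Fin w) R) (c : ℕ) :
    (Function.update g a X c).map f = Function.update (fun c => (g c).map f) a (X.map f) c := by
  by_cases h : c = a
  · subst h; simp
  · rw [Function.update_of_ne h, Function.update_of_ne h]

/-- ★ **The Hessian of `tr(B₀⋯B_{K−1})` at a point, for AFFINE factors.**  With `[x_s]B_a` the coefficient matrix of `x_s` in `B_a`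
and `B_c(z)` the value at `z`:
`Hess_z tr(B₀⋯B_{K−1})(s,t) = Σ_{a<K} Σ_{b<K, b≠a} tr(∏_c C_c)`, `C_a = [x_s]B_a`, `C_b = [x_t]B_b`, `C_c = B_c(z)` otherwise. [folklore] -/
theorem hess0_transl_trace_pprod_of_isAffine [Fintype σ] [DecidableEq σ]
    (B : ℕ → Matrix (Fin w) (Fin w) (MvPolynomial σ ℂ)) (hB : ∀ a i j, (B a i j).totalDegree ≤ 1)
    (z : σ → ℂ) (K : ℕ) (s t : σ) :
    hess0 (transl z (TraceChain.pprod w B K).trace) s t =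
      ∑ a ∈ Finset.range K, ∑ b ∈ (Finset.range K).erase a,
        (TraceChain.pprod w (Function.update (Function.update (fun c => (B c).map (eval z)) a
          ((B a).map (coeff (Finsupp.single s 1)))) b ((B b).map (coeff (Finsupp.single t 1)))) K).trace := by
  classical
  rw [hess0_transl, AddMonoidHom.map_trace (pderiv t), AddMonoidHom.map_trace (pderiv s),
    map_pderiv_map_pderiv_pprod B s t K]
  -- affine factors: `∂_c B_a = C([x_c]B_a)` and `∂_s∂_t B_a = 0`
  have hd : ∀ a (c : σ), (B a).map (pderiv c) = ((B a).map (coeff (Finsupp.single c 1))).map C :=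
    fun a c => CommutativePencil.map_pderiv_of_isAffine (hB a) c
  have hd2 : ∀ a, ((B a).map (pderiv t)).map (pderiv s) = 0 := by
    intro a
    rw [hd a t]
    ext i j
    simp
  have hzero : ∑ a ∈ Finset.range K, TraceChain.pprod w (Function.update B a (((B a).map (pderiv t)).map (pderiv s))) K = 0 := by
    refine Finset.sum_eq_zero fun a ha => ?_
    rw [Finset.mem_range] at ha
    rw [hd2 a]
    -- a zero factor kills the prefix product: induct up from `a+1`
    have : ∀ d, TraceChain.pprod w (Function.update B a 0) (a + 1 + d) = 0 := by
      intro d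
      induction d with
      | zero => rw [Nat.add_zero, TraceChain.pprod_succ, Function.update_self, Matrix.mul_zero]
      | succ d ih => rw [show a + 1 + (d + 1) = a + 1 + d + 1 by omega, TraceChain.pprod_succ, ih, Matrix.zero_mul]
    obtain ⟨d, hdK⟩ := Nat.exists_eq_add_of_le (show a + 1 ≤ K by omega)
    rw [hdK, this]
  rw [hzero, add_zero, Matrix.trace_sum, map_sum]
  refine Finset.sum_congr rfl fun a _ => ?_
  rw [Matrix.trace_sum, map_sum]
  refine Finset.sum_congr rfl fun b _ => ?_
  rw [AddMonoidHom.map_trace (eval z : MvPolynomial σ ℂ →+* ℂ), TraceChain.pprod_map]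
  congr 1
  refine pprod_congr K fun c _ => ?_
  rw [map_update, hd b t]
  congr 1
  · funext c'
    rw [map_update, hd a s]
    congr 1
    ext i j
    simp
  · ext i j
    simp

end Summit.ValiantsHypothesis.ValiantsHypothesis.Theorems.GrenetZeonTwoDimCoefficients.TraceProductHessian

end
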